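import Mathlib.Analysis.SpecialFunctions.Trigonometric.Basic
import Mathlib.Analysis.SpecialFunctions.Complex.Circle
import HarnessLib

/-!
# GRH arm (rh-explicit, venture WeilGRH): the roots of unity `e(u) = exp(2πiu)` as complex LITERALS — bridge between the two log-2 lineages

Cell `rh-explicit`, WEIL TRACK — GRH ARM (engine seat weil-grh-2 gen11).  The format-C χ-cells (this seat) key their hypotheses on
literals `χ(g) = ⟨re, im⟩` (`ω = ⟨−1/2, √3/2⟩`, `ζ₁₂ = ⟨√3/2, 1/2⟩`, `±i`, `ζ₈ = ⟨√2/2, √2/2⟩`, …), the D-K dual-certificate lineage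
(weil-grh-3) on phases `χ(g) = Complex.exp (2 * Real.pi * Complex.I * (u / v))`.  This file proves the dictionary
`exp(2πi·u/v) = ⟨cos, sin⟩` for every phase that occurs at `t = log 2` (`v ∣ 24` essentially: `u/v ∈ {±1/12, ±1/6, ±1/4, ±1/3,
±5/12, 1/2, ±1/8, ±3/8}`) plus the mod-11 reshaping `exp(2πi·(±1/5)) = exp(2πi/5)^{1,4}`, so that an assembly can consume a census
theorem of EITHER lineage for a given class.  Mathlib trigonometry only (`Real.cos_pi_div_six`, …); RH/GRH-free; standard axioms.
-/

namespace Summit.Ventures.WeilGRH.RootOfUnityLiterals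

open Complex

/-- `exp(θ i) = ⟨cos θ, sin θ⟩` for a real angle written inside `ℂ`. [folklore] -/
theorem exp_real_mul_I_eq_mk (θ : ℝ) : Complex.exp ((θ : ℂ) * Complex.I) = ⟨Real.cos θ, Real.sin θ⟩ :=
  Complex.ext (by rw [Complex.exp_ofReal_mul_I_re]) (by rw [Complex.exp_ofReal_mul_I_im])

/-- `e(1/12) = ζ₁₂ = (√3 + i)/2`. [folklore] -/
theorem exp_one_twelfth : Complex.exp (2 * Real.pi * Complex.I * (1 / 12)) = ⟨Real.sqrt 3 / 2, 1 / 2⟩ := by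
  rw [show (2 * Real.pi * Complex.I * (1 / 12) : ℂ) = (((Real.pi / 6) : ℝ) : ℂ) * Complex.I by push_cast; ring, exp_real_mul_I_eq_mk, Real.cos_pi_div_six,
    Real.sin_pi_div_six]

/-- `e(−1/12) = ζ₁₂¹¹ = (√3 − i)/2`. [folklore] -/
theorem exp_neg_one_twelfth : Complex.exp (2 * Real.pi * Complex.I * (-1 / 12)) = ⟨Real.sqrt 3 / 2, -1 / 2⟩ := by
  rw [show (2 * Real.pi * Complex.I * (-1 / 12) : ℂ) = (((-(Real.pi / 6)) : ℝ) : ℂ) * Complex.I by push_cast; ring, exp_real_mul_I_eq_mk, Real.cos_neg, Real.sin_neg,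
    Real.cos_pi_div_six, Real.sin_pi_div_six]
  norm_num

/-- `e(5/12) = ζ₁₂⁵ = (−√3 + i)/2`. [folklore] -/
theorem exp_five_twelfths : Complex.exp (2 * Real.pi * Complex.I * (5 / 12)) = ⟨-(Real.sqrt 3 / 2), 1 / 2⟩ := by
  rw [show (2 * Real.pi * Complex.I * (5 / 12) : ℂ) = (((Real.pi - Real.pi / 6) : ℝ) : ℂ) * Complex.I by push_cast; ring, exp_real_mul_I_eq_mk, Real.cos_pi_sub,
    Real.sin_pi_sub, Real.cos_pi_div_six, Real.sin_pi_div_six]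

/-- `e(−5/12) = ζ₁₂⁷ = (−√3 − i)/2`. [folklore] -/
theorem exp_neg_five_twelfths : Complex.exp (2 * Real.pi * Complex.I * (-5 / 12)) = ⟨-(Real.sqrt 3 / 2), -1 / 2⟩ := by
  rw [show (2 * Real.pi * Complex.I * (-5 / 12) : ℂ) = (((-(Real.pi - Real.pi / 6)) : ℝ) : ℂ) * Complex.I by push_cast; ring, exp_real_mul_I_eq_mk, Real.cos_neg,
    Real.sin_neg, Real.cos_pi_sub, Real.sin_pi_sub, Real.cos_pi_div_six, Real.sin_pi_div_six]
  norm_num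

/-- `e(1/6) = −ω̄ = (1 + i√3)/2`. [folklore] -/
theorem exp_one_sixth : Complex.exp (2 * Real.pi * Complex.I * (1 / 6)) = ⟨1 / 2, Real.sqrt 3 / 2⟩ := by
  rw [show (2 * Real.pi * Complex.I * (1 / 6) : ℂ) = (((Real.pi / 3) : ℝ) : ℂ) * Complex.I by push_cast; ring, exp_real_mul_I_eq_mk, Real.cos_pi_div_three,
    Real.sin_pi_div_three]

/-- `e(−1/6) = −ω = (1 − i√3)/2`. [folklore] -/
theorem exp_neg_one_sixth : Complex.exp (2 * Real.pi * Complex.I * (-1 / 6)) = ⟨1 / 2, -(Real.sqrt 3 / 2)⟩ := by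
  rw [show (2 * Real.pi * Complex.I * (-1 / 6) : ℂ) = (((-(Real.pi / 3)) : ℝ) : ℂ) * Complex.I by push_cast; ring, exp_real_mul_I_eq_mk, Real.cos_neg, Real.sin_neg,
    Real.cos_pi_div_three, Real.sin_pi_div_three]

/-- `e(1/3) = ω = (−1 + i√3)/2`. [folklore] -/
theorem exp_one_third : Complex.exp (2 * Real.pi * Complex.I * (1 / 3)) = ⟨-1 / 2, Real.sqrt 3 / 2⟩ := by
  rw [show (2 * Real.pi * Complex.I * (1 / 3) : ℂ) = (((Real.pi - Real.pi / 3) : ℝ) : ℂ) * Complex.I by push_cast; ring, exp_real_mul_I_eq_mk, Real.cos_pi_sub,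
    Real.sin_pi_sub, Real.cos_pi_div_three, Real.sin_pi_div_three]
  norm_num

/-- `e(−1/3) = ω̄ = (−1 − i√3)/2`. [folklore] -/
theorem exp_neg_one_third : Complex.exp (2 * Real.pi * Complex.I * (-1 / 3)) = ⟨-1 / 2, -(Real.sqrt 3 / 2)⟩ := by
  rw [show (2 * Real.pi * Complex.I * (-1 / 3) : ℂ) = (((-(Real.pi - Real.pi / 3)) : ℝ) : ℂ) * Complex.I by push_cast; ring, exp_real_mul_I_eq_mk, Real.cos_neg,
    Real.sin_neg, Real.cos_pi_sub, Real.sin_pi_sub, Real.cos_pi_div_three, Real.sin_pi_div_three]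
  norm_num

/-- `e(1/4) = i`. [folklore] -/
theorem exp_one_quarter : Complex.exp (2 * Real.pi * Complex.I * (1 / 4)) = Complex.I := by
  rw [show (2 * Real.pi * Complex.I * (1 / 4) : ℂ) = (((Real.pi / 2) : ℝ) : ℂ) * Complex.I by push_cast; ring, exp_real_mul_I_eq_mk, Real.cos_pi_div_two,
    Real.sin_pi_div_two]
  exact Complex.ext (by simp) (by simp)

/-- `e(−1/4) = −i`. [folklore] -/
theorem exp_neg_one_quarter : Complex.exp (2 * Real.pi * Complex.I * (-1 / 4)) = -Complex.I := by
  rw [show (2 * Real.pi * Complex.I * (-1 / 4) : ℂ) = (((-(Real.pi / 2)) : ℝ) : ℂ) * Complex.I by push_cast; ring, exp_real_mul_I_eq_mk, Real.cos_neg, Real.sin_neg,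
    Real.cos_pi_div_two, Real.sin_pi_div_two]
  exact Complex.ext (by simp) (by simp)

/-- `e(3/4) = −i`. [folklore] -/
theorem exp_three_quarters : Complex.exp (2 * Real.pi * Complex.I * (3 / 4)) = -Complex.I := by
  rw [show (2 * Real.pi * Complex.I * (3 / 4) : ℂ) = (((Real.pi / 2 + Real.pi) : ℝ) : ℂ) * Complex.I by push_cast; ring, exp_real_mul_I_eq_mk, Real.cos_add_pi,
    Real.sin_add_pi, Real.cos_pi_div_two, Real.sin_pi_div_two]
  exact Complex.ext (by simp) (by simp)

/-- `e(1/2) = −1`. [folklore] -/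
theorem exp_one_half : Complex.exp (2 * Real.pi * Complex.I * (1 / 2)) = -1 := by
  rw [show (2 * Real.pi * Complex.I * (1 / 2) : ℂ) = (((Real.pi) : ℝ) : ℂ) * Complex.I by ring, exp_real_mul_I_eq_mk, Real.cos_pi, Real.sin_pi]
  exact Complex.ext (by simp) (by simp)

/-- `e(1/8) = ζ₈ = (1 + i)/√2`. [folklore] -/
theorem exp_one_eighth : Complex.exp (2 * Real.pi * Complex.I * (1 / 8)) = ⟨Real.sqrt 2 / 2, Real.sqrt 2 / 2⟩ := by
  rw [show (2 * Real.pi * Complex.I * (1 / 8) : ℂ) = (((Real.pi / 4) : ℝ) : ℂ) * Complex.I by push_cast; ring, exp_real_mul_I_eq_mk, Real.cos_pi_div_four,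
    Real.sin_pi_div_four]

/-- `e(−1/8) = ζ₈⁷ = (1 − i)/√2`. [folklore] -/
theorem exp_neg_one_eighth : Complex.exp (2 * Real.pi * Complex.I * (-1 / 8)) = ⟨Real.sqrt 2 / 2, -(Real.sqrt 2 / 2)⟩ := by
  rw [show (2 * Real.pi * Complex.I * (-1 / 8) : ℂ) = (((-(Real.pi / 4)) : ℝ) : ℂ) * Complex.I by push_cast; ring, exp_real_mul_I_eq_mk, Real.cos_neg, Real.sin_neg,
    Real.cos_pi_div_four, Real.sin_pi_div_four]

/-- `e(3/8) = ζ₈³ = (−1 + i)/√2`. [folklore] -/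
theorem exp_three_eighths : Complex.exp (2 * Real.pi * Complex.I * (3 / 8)) = ⟨-(Real.sqrt 2 / 2), Real.sqrt 2 / 2⟩ := by
  rw [show (2 * Real.pi * Complex.I * (3 / 8) : ℂ) = (((Real.pi - Real.pi / 4) : ℝ) : ℂ) * Complex.I by push_cast; ring, exp_real_mul_I_eq_mk, Real.cos_pi_sub,
    Real.sin_pi_sub, Real.cos_pi_div_four, Real.sin_pi_div_four]

/-- `e(−3/8) = ζ₈⁵ = (−1 − i)/√2`. [folklore] -/
theorem exp_neg_three_eighths : Complex.exp (2 * Real.pi * Complex.I * (-3 / 8)) = ⟨-(Real.sqrt 2 / 2), -(Real.sqrt 2 / 2)⟩ := by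
  rw [show (2 * Real.pi * Complex.I * (-3 / 8) : ℂ) = (((-(Real.pi - Real.pi / 4)) : ℝ) : ℂ) * Complex.I by push_cast; ring, exp_real_mul_I_eq_mk, Real.cos_neg,
    Real.sin_neg, Real.cos_pi_sub, Real.sin_pi_sub, Real.cos_pi_div_four, Real.sin_pi_div_four]

/-- `e(1/5)` in the format-C cells' shape `exp(2πi/5)`. [folklore] -/
theorem exp_one_fifth : Complex.exp (2 * Real.pi * Complex.I * (1 / 5)) = Complex.exp (2 * Real.pi * Complex.I / 5) := by
  congr 1; ring

/-- `e(−1/5) = e(1/5)⁴`. [folklore] -/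
theorem exp_neg_one_fifth : Complex.exp (2 * Real.pi * Complex.I * (-1 / 5)) = Complex.exp (2 * Real.pi * Complex.I / 5) ^ 4 := by
  rw [← Complex.exp_nat_mul, show ((4 : ℕ) : ℂ) * (2 * Real.pi * Complex.I / 5) = 2 * Real.pi * Complex.I * (-1 / 5) + 2 * Real.pi * Complex.I
    by push_cast; ring, Complex.exp_add, Complex.exp_two_pi_mul_I, mul_one]

end Summit.Ventures.WeilGRH.RootOfUnityLiterals
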